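import Summits.BirchSwinnertonDyer.Rank1Residual.AdditivePotMult.PotMultBranchPAdicValIdentityRouteG
import Summits.BirchSwinnertonDyer.Rank1Residual.AdditivePotMult.PotMultCongruentPartnerEPWLines
import Summits.BirchSwinnertonDyer.Rank1Residual.Additive.CensusQ6CoeffValuation
import HarnessLib

/-!
# X4(M) ∧ surj(p) ∧ `r_an = 1`, EVERY odd `p` (`p = 3` included): the census-literal COLUMN forms of the
# Route-G valuation identity — `BSD(E,p) ⟺ ord_p q + ord_p Reg_p(E,Dh) = 1 + v₁` with `v₁` the Q6
# column `CensusQ6.MultCoeffValAt W p 1 v₁` — and the budget fed by a PLAIN congruence (cell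
# `b2b-bsdres`, team n1011, seat p07 (gen 4); closes gen-3 item (i) "the `MultCoeffValAt` interlock,
# at census-ctyper1's word" — word given 2026-08-21T10:11Z; X4(M) twin of n1011-p12's
# `PotMultX3BranchPAdicValIdentityRouteG` §4)

HONEST FRAMING (cell `b2b-bsdres`, run/shared/lean/b2b/bsd-rank1-residual/, verbatim in every
file): the goal of the cell is to DELETE the COMBINATION-SHAPED residual classes of the
Birch–Swinnerton-Dyer formula for ALL analytic-rank `≤ 1` elliptic curves over `ℚ` — "full BSD
formula for every rank `≤ 1` curve in class `C`" assembled STRICTLY from published theorems — so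
that the rank-`≤ 1` remainder becomes exactly the CONSTRUCTION-SHAPED classes, which are TYPED
(missing-input `Prop`s), NOT attempted. This is not "finishing BSD". Team n1011 (RESIDUAL-MAP §I
O7-ord on the (M) rows = X4(M) ∧ surj(p) ∧ `r_an = 1`, every odd `p`): research route on
CONSTRUCTION-SHAPED items; labels and marks UNCHANGED; nothing booked — every statement is PER PAIR
modulo the named facts AND per-pair inputs outside the kernel (the Q6 record and the Q6 COLUMN =
CERTIFICATE-EVIDENCE, never a Literature fact; the budget / the congruent partner = per-pair data).
Theorems only; NO Literature fact minted; NO definition. Named facts as HYPOTHESES only: `hK` (Kato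
17.4 (3)), `hmodD`, `hGZK`, `hmod`, and in §2 `hEPW` + `hT40`/`hT41` (published Tate uniformisation).

## What

* §1 `ClassX4M.schneider_and_padicVal_identity_rankOne_of_katoHalf_of_firstUnitIndex_of_multCoeffValAt_of_budget`,
  **`ClassX4M.bsdp_iff_padicVal_rankOne_of_katoHalf_of_firstUnitIndex_of_multCoeffValAt_of_budget`**:
  gen 3's identity / headline with the twist datum `(V, C, f, a_p, ϖ)` and the bit `[T¹](ϖ·B) ≠ 0`
  ELIMINATED in favour of census-ctyper1's typed column `MultCoeffValAt W p 1 v₁` (its §1 API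
  `MultCoeffValAt.coeff_ne_zero_and_valuation_eq` supplies both the bit and `v([T¹]) = v₁` for the
  class's own `p*`-twist model): per (B)-datum, Schneider and
  `ord_p #Ш + ord_p Reg_p + ord_p ∏c_ℓ = v₁ + 1 + 2·ord_p #tors`, and `BSD(E,p) ⟺ ord_p q + ord_p Reg_p = 1 + v₁`.
* §2 **`ClassX4M.bsdp_iff_padicVal_rankOne_of_katoHalf_of_firstUnitIndex_of_multCoeffValAt_of_congr`**:
  the same with the budget `BudgetLeLambdaAt p W n₀` DISCHARGED from an (M) congruent partner of rank
  `≥ r₁` through a PLAIN `Γ_ℚ`-equivariant `E[p] ≃+ E₁[p]` (TB-ROL sequel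
  `ClassX4M.budgetLeLambdaAt_of_epw_of_multPartner_of_congr`), `n₀ ≤ r₁ + Σ_{w∈Σ₀}(δ(E₁,w) − δ(E,w))`.
So on an X4(M) `r_an = 1` row with a Q6 record at `n₀`, the column `v₁`, and an (M) congruent partner
of enough rank, `BSD(E,p)` is ONE valuation statement about `Reg_p(E,Dh)` against census integers.
Nothing booked; O7-ord OPEN; X4(M) CONSTRUCTION-SHAPED.

References: D. Delbourgo, *A Dirichlet series expansion for the p-adic L-function* (2002) Theorem (B);
K. Kato, Astérisque 295 (2004) Thm. 17.4; M. Emerton, R. Pollack, T. Weston, Invent. Math. 163 (2006)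
Thms. 3.3.2/3.3.3, Lemma 5.1.5; R. L. Miller, LMS J. Comput. Math. 14 (2011) Def. 1.1; B. Mazur,
J. Tate, J. Teitelbaum, Invent. Math. 84 (1986) §I.10, §I.13 (the column is EVIDENCE).
-/

set_option autoImplicit false

noncomputable section

open scoped Classical MatrixGroups ModularForm NumberField

namespace Summit.BirchSwinnertonDyer.Rank1Residual.AdditivePotMult

open CongruenceSubgroup WeierstrassCurve NumberField Literature.NumberTheory.EllipticCurves
  Literature.NumberTheory.EllipticCurves.ModularForms
  Literature.NumberTheory.EllipticCurves.Rank1Residual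
  Literature.NumberTheory.EllipticCurves.Rank1Residual.Typed
  Literature.NumberTheory.EllipticCurves.Delbourgo2002
  Literature.NumberTheory.EllipticCurves.GreenbergVatsal2000
  Literature.NumberTheory.EllipticCurves.EmertonPollackWeston2006
  Literature.NumberTheory.GaloisRepresentations
  Summit.BirchSwinnertonDyer.Rank1Residual.Additive
  Summit.BirchSwinnertonDyer.Rank1Residual.Additive.CensusQ6
  IsDedekindDomain Field

/-! ### §1 The identity and the headline with the census COLUMN `MultCoeffValAt W p 1 v₁` -/

section Column

variable {W : WeierstrassCurve ℚ} [W.IsElliptic] [W.IsGloballyMinimal] {p : ℕ} [hp : Fact p.Prime]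

/-- **The `ℓ`-free valuation identity with the census column** (X4(M) ∧ surj(p) ∧ `r_an = 1`, EVERY odd
`p`): Kato's divisibility + the Q6 record at `n₀` + the budget `BudgetLeLambdaAt p W n₀` + the column
`MultCoeffValAt W p 1 v₁` ⟹ for every (B)-datum `Dh`: Schneider and
`ord_p #Ш(E) + ord_p Reg_p(E,Dh) + ord_p ∏c_ℓ = v₁ + 1 + 2·ord_p #E(ℚ)_tors`. The twist datum of gen 3's
identity is the class's own `p*`-twist model (`ClassX4M.exists_mult_pStar_twist_model`, the modular
parametrisation `hmodD`, the period ratio of the right parity); the column supplies `[T¹] ≠ 0` and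
`v([T¹]) = v₁`. [cite: Delbourgo2002, Theorem (B) (p. 40)] [cite: Kato2004Asterisque, Thm. 17.4 (3) (p. 273)]
[cite: MazurTateTeitelbaum1986Invent, §I.10, §I.13 (the column is EVIDENCE)] -/
theorem ClassX4M.schneider_and_padicVal_identity_rankOne_of_katoHalf_of_firstUnitIndex_of_multCoeffValAt_of_budget
    (hK : Wuthrich2014.kato_halfEigenCharIdeal_dvd_cyclotomicPrime_of_surjective)
    (hmodD : nonempty_modularParametrizationData)
    (hGZK : rank_eq_analyticRank_of_analyticRank_le_one)
    (hX : ClassX4M W p) (hsurj : Surj W p) (hr : W.analyticRank = 1) {n₀ : ℕ}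
    (hrec : (p % 4 = 1 → MultFirstUnitIndexAt W p n₀) ∧ (p % 4 = 3 → MultOddFirstUnitIndexAt W p n₀))
    (hbud : BudgetLeLambdaAt p W n₀) {v₁ : ℤ} (hv : MultCoeffValAt W p 1 v₁)
    {Dh : PAdicHeightData W p} (hB : LeadingTermClauses W p Dh) :
    SchneiderConjecture Dh ∧
      (padicValNat p W.shaOrder : ℤ) + (padicRegulator Dh).valuation + padicValNat p W.tamagawaProduct =
        v₁ + 1 + 2 * padicValNat p W.torsionOrder := by
  obtain ⟨V, iV, iVm, C, hV, hC⟩ := hX.exists_mult_pStar_twist_model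
  haveI : NeZero (V.conductorNorm ℤ) := ⟨(V.conductorNorm_pos_holds).ne'⟩
  obtain ⟨Dm⟩ := hmodD V
  obtain ⟨ϖ, hϖ⟩ := exists_periodRatio_parity (p := p) V Dm
  -- an integer `a_p` for the newform: `a_p = 1` (split) or `a_p = −1` (non-split)
  obtain ⟨ap, hap⟩ : ∃ ap : ℤ, cuspCoeff Dm.f p = ap := by
    by_cases hs : V.HasSplitMultiplicativeReductionAtPrime p
    · exact ⟨1, by exact_mod_cast (Dm.isNewformOf.cuspCoeff_eq_one_and_sq_of_split hs).1⟩
    · exact ⟨-1, by exact_mod_cast (Dm.isNewformOf.cuspCoeff_eq_neg_one_and_dvd_of_nonsplit hV hs).1⟩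
  obtain ⟨hne, hval⟩ := hv.coeff_ne_zero_and_valuation_eq V C hV hC Dm.f Dm.isNewformOf ap hap ϖ hϖ
  obtain ⟨hS, hid⟩ :=
    hX.schneider_and_padicVal_identity_rankOne_of_katoHalf_of_firstUnitIndex_of_budget hK hGZK hsurj hr
      hrec hbud V C hV hC Dm.isNewformOf ap hap ϖ hϖ hne hB
  rw [hval] at hid
  exact ⟨hS, hid⟩

/-- **HEADLINE with the census COLUMN (X4(M) ∧ surj(p) ∧ `r_an = 1`, EVERY odd `p`, `p = 3` included):
`BSD(E,p) ⟺ ord_p q + ord_p Reg_p(E,Dh) = 1 + v₁`** for every (B)-datum `Dh`, where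
`L'(E,1) = q·Ω_E·Reg_∞(E)` and `v₁ ∈ ℤ` is census-ctyper1's column `CensusQ6.MultCoeffValAt W p 1 v₁` —
GIVEN Kato's divisibility, the Q6 record at `n₀` and the budget `BudgetLeLambdaAt p W n₀`. The residue
of `BSD(E,p)` on these rows is ONE `p`-adic valuation `v(Reg_p)` against two census integers
(`ord_p q`, `v₁`). Nothing booked; O7-ord OPEN. [cite: Delbourgo2002, Theorem (B) (p. 40)]
[cite: Kato2004Asterisque, Thm. 17.4 (3) (p. 273)] [cite: Miller2011LMS, Def. 1.1]
[cite: MazurTateTeitelbaum1986Invent, §I.10, §I.13 (the column is EVIDENCE)] -/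
theorem ClassX4M.bsdp_iff_padicVal_rankOne_of_katoHalf_of_firstUnitIndex_of_multCoeffValAt_of_budget
    (hK : Wuthrich2014.kato_halfEigenCharIdeal_dvd_cyclotomicPrime_of_surjective)
    (hmodD : nonempty_modularParametrizationData)
    (hGZK : rank_eq_analyticRank_of_analyticRank_le_one) (hmod : hasEntireLFunction_rat)
    (hX : ClassX4M W p) (hsurj : Surj W p) (hr : W.analyticRank = 1) {n₀ : ℕ}
    (hrec : (p % 4 = 1 → MultFirstUnitIndexAt W p n₀) ∧ (p % 4 = 3 → MultOddFirstUnitIndexAt W p n₀))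
    (hbud : BudgetLeLambdaAt p W n₀) {v₁ : ℤ} (hv : MultCoeffValAt W p 1 v₁)
    {Dh : PAdicHeightData W p} (hB : LeadingTermClauses W p Dh)
    {q : ℚ} (hLq : W.leadingLCoeff = (q : ℂ) * (W.realPeriodRat : ℂ) * (W.regulator : ℂ)) :
    BSDp W p ↔ padicValRat p q + (padicRegulator Dh).valuation = 1 + v₁ := by
  obtain ⟨-, hid⟩ :=
    hX.schneider_and_padicVal_identity_rankOne_of_katoHalf_of_firstUnitIndex_of_multCoeffValAt_of_budget
      hK hmodD hGZK hsurj hr hrec hbud hv hB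
  have hq0 : q ≠ 0 := by
    rintro rfl
    rw [Rat.cast_zero, zero_mul, zero_mul] at hLq
    exact W.leadingLCoeff_ne_zero_holds (hmod W) hLq
  have hid' : (padicValNat p W.shaOrder : ℤ) + ((padicRegulator Dh).valuation - v₁) +
      padicValNat p W.tamagawaProduct = 1 + 2 * padicValNat p W.torsionOrder := by
    linarith
  have h := bsdp_iff_padicValRat_add_eq_one (W := W) (p := p) hGZK (by rw [hr]) hq0 hLq hid'
  rw [h]
  constructor <;> intro h' <;> linarith

end Column

/-! ### §2 The same with the budget from an (M) congruent partner through a PLAIN congruence -/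

section Congr

variable {W W₁ : WeierstrassCurve ℚ} [W.IsElliptic] [W.IsGloballyMinimal] [W₁.IsElliptic]
  [W₁.IsGloballyMinimal] {p : ℕ} [hp : Fact p.Prime]

/-- **HEADLINE, (M)–(M) congruent-partner form — lines and line-matching DISCHARGED (TB-ROL).**
X4(M) ∧ surj(p) ∧ `r_an = 1` row `E = W` with the Q6 record at `n₀` and the column `v₁`; partner
`E₁ = W₁` X4(M) ∧ surj(p) with `r₁ ≤ rank E₁(ℚ)`; a PLAIN `Γ_ℚ`-equivariant `E[p] ≃+ E₁[p]`; `Σ₀ ∌ p`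
outside which both are good; `n₀ ≤ r₁ + Σ_{w∈Σ₀} (δ(E₁,w) − δ(E,w))`. Then for every (B)-datum,
`BSD(E,p) ⟺ ord_p q + ord_p Reg_p(E,Dh) = 1 + v₁` (the budget is
`ClassX4M.budgetLeLambdaAt_of_epw_of_multPartner_of_congr`). Named facts: `hK`, `hEPW`, `hmodD`, `hGZK`,
`hmod`, `hT40`, `hT41`. PER PAIR; nothing booked; O7-ord OPEN.
[cite: Delbourgo2002, Theorem (B) (p. 40)] [cite: Kato2004Asterisque, Thm. 17.4 (3) (p. 273)]
[cite: EmertonPollackWeston2006, Thm. 3.3.2, Thm. 3.3.3 (2) (arXiv:math/0404484 p. 19), Lemma 5.1.5 (p. 30) and pp. 2–3]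
[cite: SilvermanATAEC1994, Ch. V Thm. 5.3, Cor. 5.4] -/
theorem ClassX4M.bsdp_iff_padicVal_rankOne_of_katoHalf_of_firstUnitIndex_of_multCoeffValAt_of_congr
    (hK : Wuthrich2014.kato_halfEigenCharIdeal_dvd_cyclotomicPrime_of_surjective)
    (hEPW : muLambdaAlg_transfer_of_torsionIso_potOrd)
    (hmodD : nonempty_modularParametrizationData)
    (hGZK : rank_eq_analyticRank_of_analyticRank_le_one) (hmod : hasEntireLFunction_rat)
    (hT40 : Silverman1994_thmV53_tateUniformisation.{0})
    (hT41 : Silverman1994_thmV53_corV54_tateUniformisation.{0})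
    (hX : ClassX4M W p) (hsurj : Surj W p) (hr : W.analyticRank = 1) {n₀ : ℕ}
    (hrec : (p % 4 = 1 → MultFirstUnitIndexAt W p n₀) ∧ (p % 4 = 3 → MultOddFirstUnitIndexAt W p n₀))
    {v₁ : ℤ} (hv : MultCoeffValAt W p 1 v₁)
    (hX₁ : ClassX4M W₁ p) (hsurj₁ : Surj W₁ p) {r₁ : ℕ} (hr₁ : r₁ ≤ W₁.mordellWeilRank)
    {v : HeightOneSpectrum (𝓞 ℚ)} (hpv : ((p : ℕ) : 𝓞 ℚ) ∈ v.asIdeal)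
    (hcong : ∃ e : geomTorsion W (p : ℤ) ≃+ geomTorsion W₁ (p : ℤ),
      ∀ (σ : absoluteGaloisGroup ℚ) (P : geomTorsion W (p : ℤ)), e (σ • P) = σ • e P)
    (S₀ : Finset (HeightOneSpectrum (𝓞 ℚ))) (hS₀ : ∀ w ∈ S₀, ((p : ℕ) : 𝓞 ℚ) ∉ w.asIdeal)
    (hS : ∀ w : HeightOneSpectrum (𝓞 ℚ), w ∉ S₀ → ((p : ℕ) : 𝓞 ℚ) ∉ w.asIdeal →
      W.HasGoodReductionAt w)
    (hS₁ : ∀ w : HeightOneSpectrum (𝓞 ℚ), w ∉ S₀ → ((p : ℕ) : 𝓞 ℚ) ∉ w.asIdeal →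
      W₁.HasGoodReductionAt w)
    (hn₀ : (n₀ : ℤ) ≤ r₁ + ∑ w ∈ S₀, ((delta W₁ p w : ℤ) - (delta W p w : ℤ)))
    {Dh : PAdicHeightData W p} (hB : LeadingTermClauses W p Dh)
    {q : ℚ} (hLq : W.leadingLCoeff = (q : ℂ) * (W.realPeriodRat : ℂ) * (W.regulator : ℂ)) :
    BSDp W p ↔ padicValRat p q + (padicRegulator Dh).valuation = 1 + v₁ :=
  hX.bsdp_iff_padicVal_rankOne_of_katoHalf_of_firstUnitIndex_of_multCoeffValAt_of_budget hK hmodD hGZK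
    hmod hsurj hr hrec
    (hX.budgetLeLambdaAt_of_epw_of_multPartner_of_congr hK hmodD hEPW hT40 hT41 hX₁ hsurj₁ hr₁ hpv hcong
      S₀ hS₀ hS hS₁ hn₀) hv hB hLq

end Congr

end Summit.BirchSwinnertonDyer.Rank1Residual.AdditivePotMult

end
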